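import Literature.Analysis.Convolution.DixmierMalliavinDecay
import Literature.Analysis.Convolution.DixmierMalliavinKernel
import HarnessLib

/-!
# Dixmier–Malliavin on the real line — the discharge `DixmierMalliavin_real_holds`

Topic `Literature/Analysis/Convolution`.  Theorems only.  This file closes the named fact
`Literature.Analysis.Convolution.DixmierMalliavin_real` (`DixmierMalliavin.lean`): every smooth compactly
supported `φ : ℝ → ℂ` is a finite sum `Σ_i f_i ∗ ψ_i` of convolutions of smooth compactly supported
functions — J. Dixmier, P. Malliavin, *Factorisations de fonctions et de vecteurs indéfiniment
différentiables*, Bull. Sci. Math. (2) **102** (1978) 305–330, §3 Théorème 3.1 (case `G = ℝ`)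
[DixmierMalliavin1978]; D. Hegde, arXiv:2103.05495, §3.3 Thm. 18 and Rem. 15 ("any test function `φ` on
the real line can be written as `φ = Φ ∗ f − h ∗ φ`") [Hegde2021].

The proof is distributed over the modules of this directory (cell rh-crit/cc, seats t4 / t14 / t11):

* `DixmierMalliavinProduct.lean` (I) — admissible scales `c`, the multipliers
  `r_k = Π_{n≥k} (1 + (2π c_n ξ)²)⁻¹`, the kernels `ψ_k = 𝓕 r_k`, the coefficients `b_j` (`b₀ = 1`), the
  kernel identity `Σ_{j<n} (−1)ʲ b_j ψ₀^{(2j)} = 𝓕(s_n r₀)` and the approximate identity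
  `∫ 𝓕(s_n r₀) σ → σ(0)`; the choice of scales against any prescribed growth;
* `StripShiftFourierDecay.lean` + `DixmierMalliavinAnnulus.lean` + `DixmierMalliavinDecay.lean` (II) —
  the contour shift in a strip, the chain estimates, and the UNIFORM ANNULUS BOUNDS
  `DixmierMalliavin.exists_annulus_bound_half :
   ∃ K, ∀ c admissible, ∀ n x, 1/2 ≤ |x| → ‖ψ₀^{(n)}(x)‖ ≤ K n`;
* `DixmierMalliavinKernel.lean` (III) — the cut-off kernel `f = ωψ₀`, the commutator series `h`, and
  `DixmierMalliavin.dixmierMalliavin_real_of_annulusBound : (annulus bounds) → DixmierMalliavin_real`,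
  through the factorization step `dixmierMalliavin_real_of_kernels_of_pos`
  (`DixmierMalliavinFactorization.lean`, "B").

RH-context: `DixmierMalliavin_real` is the one classical input of the OFF-PATH strong form of
Connes–Consani 2021 Thm. 4.7 (`Literature.NumberTheory.ConnesConsani2021.CC2021_thm_4_7_of_dixmierMalliavin`),
which is thereby reduced to `CC2021_prop_2_2_iii` alone.  Pure classical analysis; nothing here bears on
the truth of RH.

## References
* J. Dixmier, P. Malliavin, Bull. Sci. Math. (2) 102 (1978) 305–330, §3 Thm. 3.1. [DixmierMalliavin1978]
* D. Hegde, arXiv:2103.05495 (2021), §3.1–§3.3 (Lemma 10, Claim 13, Lemma 14, Thm. 18, Rem. 15). [Hegde2021]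
-/

noncomputable section

open MeasureTheory
open scoped ContDiff Convolution

namespace Literature.Analysis.Convolution

/-- **Dixmier–Malliavin on `ℝ` (Dixmier–Malliavin 1978, Thm. 3.1 for `G = ℝ`) — PROVED**: every smooth
compactly supported `φ : ℝ → ℂ` is a finite sum of convolutions `Σ_i f_i ∗ ψ_i` of smooth compactly
supported functions.  Assembly of modules I–III: the uniform annulus bounds
(`DixmierMalliavin.exists_annulus_bound_half`) feed the kernel package and the factorization step
(`DixmierMalliavin.dixmierMalliavin_real_of_annulusBound`).
[cite: DixmierMalliavin1978, §3 Thm. 3.1] [cite: Hegde2021, §3.3 Thm. 18, Rem. 15] -/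
theorem DixmierMalliavin_real_holds : DixmierMalliavin_real := by
  obtain ⟨K, hK⟩ := DixmierMalliavin.exists_annulus_bound_half
  exact DixmierMalliavin.dixmierMalliavin_real_of_annulusBound K hK

/-- The statement unfolded: for every smooth compactly supported `φ : ℝ → ℂ` there are `N` and smooth
compactly supported `f_i, ψ_i` (`i < N`) with `φ = Σ_i f_i ⋆ ψ_i` (Mathlib convolution for
`ContinuousLinearMap.mul ℂ ℂ` and Lebesgue measure). [cite: DixmierMalliavin1978, §3 Thm. 3.1] -/
theorem exists_eq_sum_convolution_of_contDiff_of_hasCompactSupport {φ : ℝ → ℂ}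
    (hφ : ContDiff ℝ ∞ φ) (hφc : HasCompactSupport φ) :
    ∃ (N : ℕ) (f ψ : Fin N → ℝ → ℂ), (∀ i, ContDiff ℝ ∞ (f i) ∧ HasCompactSupport (f i)) ∧
      (∀ i, ContDiff ℝ ∞ (ψ i) ∧ HasCompactSupport (ψ i)) ∧
      φ = ∑ i, (f i ⋆[ContinuousLinearMap.mul ℂ ℂ, volume] ψ i) :=
  DixmierMalliavin_real_holds φ hφ hφc

end Literature.Analysis.Convolution
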